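import Summits.CriticalPhenomena.PercolationContinuityZ3.Theorems.PercNearOneGluingNoHeavyPcintSignedConfigGlue
import HarnessLib

/-!
# CriticalPhenomena/PercolationContinuityZ3 — Theorems/PercNearOneGluingNoHeavyPcintSignedConfigItems.lean: the FIRST ITEM of a signed configuration and the interval calculus of the split `α = I ⊔ Iᶜ`

Lane prim-pcint, STRUCTURE rule «numerics ⇒ structure ⇒ conjecture» (prim-pcint-2 GEN 22); sequel of …PcintSignedConfigGlue.  The top level of
the forest decomposition, read sequentially: every configuration on a non-empty finite linear order has a FIRST ITEM `fstItem c` — the smallest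
non-empty closed initial segment — which is either a single letter or an INDECOMPOSABLE arch (`indec_or_card_fstItem`); an ITEM (`IsItem`) is a
configuration of one of these two kinds with no proper closed interval of weight zero.  For a configuration closed on a non-empty initial segment
`I` whose restriction to `I` is an item we classify the closed initial segments (they contain `I`: `subset_of_init_closed`) and the closed intervals
(inside `I`, inside `Iᶜ`, or containing `I`: `convex_closed_cases`), with the corresponding weight identities.  The sequel …PcintSignedConfigSplit
turns this into the first-item recursion for the prefixed classes `G(top, W, wP, S)`.

HONEST FRAMING: elementary finite combinatorics.  No `sorry`; standard axioms.  Written by prim-pcint-2 gen 22 (prover-prim-pcint-2-g22-0), 2026-08-27.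
-/

namespace Summit.CriticalPhenomena.PercolationContinuityZ3.Theorems.Pcint.ChordDiag

variable {α β : Type*} [LinearOrder α] [Fintype α] [LinearOrder β] [Fintype β]

/-! ### Items -/

/-- An ITEM with sign word `T`: a well-formed configuration with no proper closed interval of weight zero that is indecomposable or a single
point (then a letter). [folklore] -/
def IsItem (T : List Bool) (c : Cfg α) : Prop := IsCfg c ∧ sw c = T ∧ PropSAW c ∧ (Indec c ∨ Fintype.card α = 1)

open Classical in
/-- The finite set of items with sign word `T` on `α`. [folklore] -/
noncomputable def itemSet (T : List Bool) (α : Type*) [LinearOrder α] [Fintype α] : Finset (Cfg α) :=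
  Finset.univ.filter fun c => IsItem T c

/-- Membership in `itemSet`. [folklore] -/
theorem mem_itemSet {T : List Bool} {c : Cfg α} : c ∈ itemSet T α ↔ IsItem T c := by
  simp [itemSet]

/-- The counting function of items on `N` points. [folklore] -/
noncomputable def iCount (T : List Bool) (N : ℕ) : ℕ := (itemSet T (Fin N)).card

/-- Items are transported. [folklore] -/
theorem IsItem.conj (e : α ≃o β) {T : List Bool} {c : Cfg α} (h : IsItem T c) : IsItem T (Cfg.conj e c) :=
  ⟨h.1.conj e, (sw_conj e c).trans h.2.1, h.2.2.1.conj e,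
    h.2.2.2.imp (fun hi => hi.conj e) fun h1 => (Fintype.card_congr e.toEquiv).symm.trans h1⟩

/-- `#items` is an order-isomorphism invariant. [folklore] -/
theorem card_itemSet_congr (e : α ≃o β) (T : List Bool) : (itemSet T α).card = (itemSet T β).card := by
  refine Finset.card_nbij' (Cfg.conj e) (Cfg.conj e.symm) ?_ ?_ ?_ ?_
  · intro c hc; rw [Finset.mem_coe, mem_itemSet] at hc ⊢; exact hc.conj e
  · intro c hc; rw [Finset.mem_coe, mem_itemSet] at hc ⊢; exact hc.conj e.symm
  · intro c _; exact conj_symm_conj e c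
  · intro c _
    have := conj_symm_conj e.symm c
    simpa using this

omit [Fintype α] in
/-- A part counts as `Fin` of its size (items). [folklore] -/
theorem card_itemSet_coe (A : Finset α) (T : List Bool) : (itemSet T ↥A).card = iCount T A.card :=
  (card_itemSet_congr (A.orderIsoOfFin rfl) T).symm

/-! ### List weights and total weight -/

/-- The weight of a sign word. [folklore] -/
def lwt (T : List Bool) : ℤ := (T.map fun b => if b then (1 : ℤ) else -1).sum

/-- `lwt` of a concatenation. [folklore] -/
theorem lwt_append (T T' : List Bool) : lwt (T ++ T') = lwt T + lwt T' := by
  simp [lwt]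

/-- The total weight of a configuration is the weight of its sign word. [folklore] -/
theorem wt_univ (c : Cfg α) : wt c Finset.univ = lwt (sw c) := by
  classical
  unfold wt lwt sw
  rw [List.map_map, ← List.sum_toFinset _ (Finset.sort_nodup _ _), Finset.sort_toFinset]
  rw [← Finset.sum_subset (Finset.subset_univ (letters c))]
  · refine Finset.sum_congr rfl fun t ht => ?_
    rw [mem_letters] at ht
    simp [sgn, ht]
  · intro t _ ht
    rw [mem_letters] at ht
    exact sgn_of_not_letter ht

omit [Fintype α] in
/-- The weight of a closed part is the weight of the sign word of the restriction. [folklore] -/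
theorem wt_eq_lwt_sw_resC {c : Cfg α} {S : Finset α} (hS : Closed c.1 S) : wt c S = lwt (sw (resC c S)) := by
  rw [← wt_univ, wt_resC hS, up_univ]

omit [Fintype α] in
/-- Weights split along a part. [folklore] -/
theorem wt_split (c : Cfg α) (J S : Finset α) : wt c J = wt c (J.filter (· ∈ S)) + wt c (J.filter (· ∉ S)) := by
  unfold wt
  rw [← Finset.sum_filter_add_sum_filter_not J (· ∈ S)]

/-! ### The first item -/

open Classical in
/-- The FIRST ITEM: the intersection of all non-empty closed initial segments (the smallest one). [folklore] -/
noncomputable def fstItem (c : Cfg α) : Finset α :=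
  Finset.univ.filter fun x => ∀ J : Finset α, J.Nonempty → Init J → Closed c.1 J → x ∈ J

/-- Membership in the first item. [folklore] -/
theorem mem_fstItem {c : Cfg α} {x : α} : x ∈ fstItem c ↔ ∀ J : Finset α, J.Nonempty → Init J → Closed c.1 J → x ∈ J := by
  simp [fstItem]

/-- The first item is contained in every non-empty closed initial segment. [folklore] -/
theorem fstItem_subset {c : Cfg α} {J : Finset α} (hne : J.Nonempty) (hi : Init J) (hcl : Closed c.1 J) : fstItem c ⊆ J :=
  fun _ hx => mem_fstItem.1 hx J hne hi hcl

/-- The first item is an initial segment. [folklore] -/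
theorem init_fstItem (c : Cfg α) : Init (fstItem c) := fun _ hx _ hyx =>
  mem_fstItem.2 fun J hne hi hcl => hi (mem_fstItem.1 hx J hne hi hcl) hyx

/-- The first item is closed. [folklore] -/
theorem closed_fstItem (c : Cfg α) : Closed c.1 (fstItem c) := fun _ hx =>
  mem_fstItem.2 fun J hne hi hcl => hcl (mem_fstItem.1 hx J hne hi hcl)

/-- The least point lies in every non-empty initial segment. [folklore] -/
theorem min_mem_of_init {J : Finset α} (hne : J.Nonempty) (hi : Init J) (hu : (Finset.univ : Finset α).Nonempty) :
    Finset.univ.min' hu ∈ J := by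
  obtain ⟨y, hy⟩ := hne
  exact hi hy (Finset.min'_le _ _ (Finset.mem_univ y))

/-- The first item of a configuration on a non-empty order is non-empty. [folklore] -/
theorem fstItem_nonempty (c : Cfg α) (hu : (Finset.univ : Finset α).Nonempty) : (fstItem c).Nonempty :=
  ⟨Finset.univ.min' hu, mem_fstItem.2 fun _ hne hi _ => min_mem_of_init hne hi hu⟩

/-- **The first item is a single point or indecomposable.** [folklore] -/
theorem indec_or_card_fstItem {c : Cfg α} (hu : (Finset.univ : Finset α).Nonempty) :
    Indec (resC c (fstItem c)) ∨ Fintype.card ↥(fstItem c) = 1 := by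
  classical
  set I := fstItem c with hIdef
  have hcl : Closed c.1 I := closed_fstItem c
  by_cases h1 : Fintype.card ↥I = 1
  · exact Or.inr h1
  left
  have hIne : I.Nonempty := fstItem_nonempty c hu
  refine ⟨?_, fun J' hne hi hclJ => ?_⟩
  · -- some point of `I` is paired: otherwise `{min}` is a closed initial segment, so `I = {min}`
    by_contra hall
    push Not at hall
    set m := Finset.univ.min' hu
    have hm : ({m} : Finset α).Nonempty := Finset.singleton_nonempty m
    have hmi : Init ({m} : Finset α) := fun x hx y hyx => by
      rw [Finset.mem_singleton] at hx ⊢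
      exact le_antisymm (hx ▸ hyx) (Finset.min'_le _ _ (Finset.mem_univ y))
    have hmI : m ∈ I := min_mem_of_init hIne (init_fstItem c) hu
    have hmcl : Closed c.1 {m} := fun x hx => by
      rw [Finset.mem_singleton] at hx ⊢
      subst hx
      have := hall ⟨_, hmI⟩
      rwa [resC_letter_iff hcl] at this
    have hsub : I ⊆ {m} := fstItem_subset hm hmi hmcl
    apply h1
    rw [Fintype.card_coe, Finset.card_eq_one]
    exact ⟨m, Finset.Subset.antisymm hsub (Finset.singleton_subset_iff.2 hmI)⟩
  · -- a non-empty closed initial segment of the item lifts to one of `c`, which contains `I`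
    have h := fstItem_subset (c := c) ((up_nonempty_iff J').2 hne) ((init_up_iff (init_fstItem c) J').2 hi)
      ((closed_resC_iff hcl J').1 hclJ)
    exact (up_eq_iff_eq_univ J').1 (Finset.Subset.antisymm (up_subset J') h)

/-! ### The split `α = I ⊔ Iᶜ` of a configuration whose restriction to the initial segment `I` is an item -/

section Split

variable {c : Cfg α} {I : Finset α}

omit [LinearOrder α] [Fintype α] in
/-- In a part of size one any two points coincide. [folklore] -/
theorem subset_of_card_eq_one {I : Finset α} (h1 : Fintype.card ↥I = 1) {x y : α} (hx : x ∈ I) (hy : y ∈ I) : x = y := by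
  have := Fintype.card_le_one_iff.1 h1.le ⟨x, hx⟩ ⟨y, hy⟩
  exact congrArg Subtype.val this

/-- **Closed initial segments contain the first item** (restriction to `I` an item, `I` a non-empty initial segment). [folklore] -/
theorem subset_of_init_closed (hI : Init I) (hIne : I.Nonempty) (hcl : Closed c.1 I) (hit : Indec (resC c I) ∨ Fintype.card ↥I = 1)
    {J : Finset α} (hne : J.Nonempty) (hi : Init J) (hclJ : Closed c.1 J) : I ⊆ J := by
  classical
  have hu : (Finset.univ : Finset α).Nonempty := ⟨hIne.choose, Finset.mem_univ _⟩
  have hmJ := min_mem_of_init hne hi hu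
  have hmI := min_mem_of_init hIne hI hu
  rcases hit with hit | h1
  · -- the trace of `J` on `I` is a non-empty closed initial segment of the item
    set J' : Finset ↥I := J.subtype (· ∈ I)
    have hJ'ne : J'.Nonempty := ⟨⟨_, hmI⟩, Finset.mem_subtype.2 hmJ⟩
    have hJ'i : Init J' := fun x hx y hyx => Finset.mem_subtype.2 (hi (Finset.mem_subtype.1 hx) hyx)
    have hJ'cl : Closed (resC c I).1 J' := fun x hx => by
      rw [Finset.mem_subtype] at hx ⊢
      rw [resC_fst_val hcl]
      exact hclJ hx
    have hJ' := hit.2 J' hJ'ne hJ'i hJ'cl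
    intro x hx
    have : (⟨x, hx⟩ : ↥I) ∈ J' := hJ' ▸ Finset.mem_univ _
    exact Finset.mem_subtype.1 this
  · intro x hx
    rw [subset_of_card_eq_one h1 hx hmI]
    exact hmJ

omit [Fintype α] in
/-- **A closed interval meeting both `I` and `Iᶜ` contains `I`.** [folklore] -/
theorem subset_of_convex_closed (hc0 : IsCfg c) (hI : Init I) (hcl : Closed c.1 I) (hit : Indec (resC c I) ∨ Fintype.card ↥I = 1)
    {J : Finset α} (hc : Convex J) (hclJ : Closed c.1 J) {a b : α} (ha : a ∈ J) (haI : a ∈ I) (hb : b ∈ J) (hbI : b ∉ I) :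
    I ⊆ J := by
  classical
  -- `J ∩ I` is an upper part of `I`; its complement in `I` is a closed initial segment of the item
  have hup : ∀ x ∈ I, a ≤ x → x ∈ J := fun x hxI hax => by
    have hxb : x ≤ b := by
      by_contra h
      exact hbI (hI hxI (not_le.1 h).le)
    exact hc ha hb hax hxb
  rcases hit with hit | h1
  · set K : Finset ↥I := Finset.univ.filter fun x => (x : α) ∉ J
    by_cases hK : K.Nonempty
    · exfalso
      have hKi : Init K := fun x hx y hyx => by
        rw [Finset.mem_filter] at hx ⊢
        refine ⟨Finset.mem_univ _, fun hyJ => hx.2 ?_⟩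
        by_cases hax : a ≤ (x : α)
        · exact hup x x.2 hax
        · exact hc hyJ ha hyx (not_le.1 hax).le
      have hKcl : Closed (resC c I).1 K := fun x hx => by
        rw [Finset.mem_filter] at hx ⊢
        refine ⟨Finset.mem_univ _, fun h => hx.2 ?_⟩
        rw [resC_fst_val hcl] at h
        have := hclJ h
        rwa [hc0.1] at this
      have hK' := hit.2 K hK hKi hKcl
      have : (⟨a, haI⟩ : ↥I) ∈ K := hK' ▸ Finset.mem_univ _
      exact (Finset.mem_filter.1 this).2 ha
    · intro x hxI
      by_contra hxJ
      exact hK ⟨⟨x, hxI⟩, Finset.mem_filter.2 ⟨Finset.mem_univ _, hxJ⟩⟩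
  · intro x hx
    rw [subset_of_card_eq_one h1 hx haI]
    exact ha

/-- The complement of an initial segment is convex. [folklore] -/
theorem convex_compl_of_init (hI : Init I) : Convex Iᶜ := fun x hx y _ t hxt _ => by
  rw [Finset.mem_compl] at hx ⊢
  exact fun ht => hx (hI ht hxt)

omit [Fintype α] in
/-- The trace on `I` of a set containing `I` is `I`. [folklore] -/
theorem filter_mem_eq_of_subset {J : Finset α} (h : I ⊆ J) : J.filter (· ∈ I) = I := by
  ext x
  rw [Finset.mem_filter]
  exact ⟨fun h' => h'.2, fun hx => ⟨h hx, hx⟩⟩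

/-- Filtering by `∉ I` is filtering by `∈ Iᶜ`. [folklore] -/
theorem filter_not_mem_eq (J : Finset α) : J.filter (· ∉ I) = J.filter (· ∈ Iᶜ) :=
  Finset.filter_congr fun x _ => by rw [Finset.mem_compl]

omit [Fintype α] in
/-- The weight of the trace on a closed part is a weight of the restriction. [folklore] -/
theorem wt_filter_eq_wt_resC {S : Finset α} (hS : Closed c.1 S) (J : Finset α) :
    wt c (J.filter (· ∈ S)) = wt (resC c S) (J.subtype (· ∈ S)) := by
  rw [wt_resC hS, up_subtype]

/-- **Weight of a set containing the closed initial segment `I`**: `wt J = wt I + wt (J ∩ Iᶜ)` read in the restriction. [folklore] -/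
theorem wt_eq_of_subset (hcl : Closed c.1 I) (hc0 : IsCfg c) {J : Finset α} (h : I ⊆ J) :
    wt c J = lwt (sw (resC c I)) + wt (resC c Iᶜ) (J.subtype (· ∈ Iᶜ)) := by
  rw [wt_split c J I, filter_mem_eq_of_subset h, wt_eq_lwt_sw_resC hcl, filter_not_mem_eq,
    wt_filter_eq_wt_resC (hc0.closed_compl hcl)]

omit [Fintype α] in
/-- A set inside a closed part weighs as its trace in the restriction. [folklore] -/
theorem wt_eq_of_subset_part {S : Finset α} (hS : Closed c.1 S) {J : Finset α} (h : J ⊆ S) :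
    wt c J = wt (resC c S) (J.subtype (· ∈ S)) := by
  rw [← wt_filter_eq_wt_resC hS]
  congr 1
  ext x
  rw [Finset.mem_filter]
  exact ⟨fun hx => ⟨hx, h hx⟩, fun hx => hx.1⟩

omit [Fintype α] in
/-- A set inside a part is the lift of its trace. [folklore] -/
theorem up_subtype_of_subset {S : Finset α} {J : Finset α} (h : J ⊆ S) : up (J.subtype (· ∈ S)) = J := by
  rw [up_subtype]
  ext x
  rw [Finset.mem_filter]
  exact ⟨fun hx => hx.1, fun hx => ⟨hx, h hx⟩⟩

/-- The trace on `Iᶜ` of an initial segment is an initial segment of `↥Iᶜ`. [folklore] -/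
theorem init_subtype_compl {J : Finset α} (hi : Init J) : Init (J.subtype (· ∈ Iᶜ)) := fun _ hx _ hyx =>
  Finset.mem_subtype.2 (hi (Finset.mem_subtype.1 hx) hyx)

/-- `I` together with the lift of an initial segment of `↥Iᶜ` is an initial segment. [folklore] -/
theorem init_union_up (hI : Init I) {J' : Finset ↥(Iᶜ)} (hi : Init J') : Init (I ∪ up J') := by
  intro x hx y hyx
  rw [Finset.mem_union] at hx ⊢
  by_cases hyI : y ∈ I
  · exact Or.inl hyI
  right
  rcases hx with hx | hx
  · exact absurd (hI hx hyx) hyI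
  · obtain ⟨hxI, hx'⟩ := mem_up.1 hx
    exact mem_up.2 ⟨Finset.mem_compl.2 hyI, hi hx' (show (⟨y, Finset.mem_compl.2 hyI⟩ : ↥(Iᶜ)) ≤ ⟨x, hxI⟩ from hyx)⟩

/-- `I` together with the lift of a closed set of the rest is closed. [folklore] -/
theorem closed_union_up (hcl : Closed c.1 I) (hc0 : IsCfg c) {J' : Finset ↥(Iᶜ)} (h : Closed (resC c Iᶜ).1 J') :
    Closed c.1 (I ∪ up J') := by
  intro x hx
  rw [Finset.mem_union] at hx ⊢
  rcases hx with hx | hx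
  · exact Or.inl (hcl hx)
  · exact Or.inr ((closed_resC_iff (hc0.closed_compl hcl) J').1 h hx)

/-- The trace on `Iᶜ` of `I ∪ up J'` is `J'`. [folklore] -/
theorem subtype_union_up (J' : Finset ↥(Iᶜ)) : (I ∪ up J').subtype (· ∈ Iᶜ) = J' := by
  ext x
  rw [Finset.mem_subtype, Finset.mem_union, coe_mem_up]
  constructor
  · rintro (h | h)
    · exact absurd h (Finset.mem_compl.1 x.2)
    · exact h
  · exact Or.inr

/-- A set containing `I` is `I ∪` the lift of its trace on `Iᶜ`. [folklore] -/
theorem eq_union_up_of_subset {J : Finset α} (h : I ⊆ J) : J = I ∪ up (J.subtype (· ∈ Iᶜ)) := by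
  ext x
  rw [Finset.mem_union, up_subtype, Finset.mem_filter, Finset.mem_compl]
  constructor
  · intro hx
    by_cases hxI : x ∈ I
    · exact Or.inl hxI
    · exact Or.inr ⟨hx, hxI⟩
  · rintro (hx | ⟨hx, -⟩)
    · exact h hx
    · exact hx

/-- `I ∪ up J' = univ` iff `J' = univ`. [folklore] -/
theorem union_up_eq_univ_iff (J' : Finset ↥(Iᶜ)) : I ∪ up J' = Finset.univ ↔ J' = Finset.univ := by
  constructor
  · intro h
    refine Finset.eq_univ_iff_forall.2 fun x => ?_
    have hx : (x : α) ∈ I ∪ up J' := h ▸ Finset.mem_univ _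
    rw [Finset.mem_union, coe_mem_up] at hx
    exact hx.resolve_left (Finset.mem_compl.1 x.2)
  · rintro rfl
    rw [up_univ]
    ext x
    simp only [Finset.mem_union, Finset.mem_compl, Finset.mem_univ, iff_true]
    exact em _

end Split

end Summit.CriticalPhenomena.PercolationContinuityZ3.Theorems.Pcint.ChordDiag
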